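import Mathlib
import Summits.KontsevichZagierPeriods.Zeta5Search.UniversalDigitDischarge
import Summits.KontsevichZagierPeriods.Zeta5Search.UniversalDigitCells
import Summits.KontsevichZagierPeriods.Zeta5Search.MixedPairTermwiseProof
import HarnessLib

/-!
# ζ(5) search — the SHIFT RULE mod `p` for the deep moment sums is a THEOREM (`GHatShiftMoments`, gen-2 g9 REPORT §6.1 (d))

Cell `pub-zeta5` (HONEST FRAMING: systematic search; no irrationality claim unless certified), typer seat
generation 9.  Discharges BY NAME `GHatShiftMoments` (`Zeta5Search/UniversalDigitCells.lean` §5): when `−N` bounds every class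
exponent from below, the depth-`N` moment sums of `b + e_j` are, modulo `p`, the `π_j`-weighted moment sums of `b`,
`π_j(x) = (b_j − x)(b₀ − b_j − x)`.

PROOF.  The shift raises `netExp` by one exactly at the two moved points `b_j`, `b₀ − b_j` (`CellA.netExp_shift_eq`, P1 g5), so a
class keeps its exponent iff it contains neither (else it rises by `≥ 1`); hence the deep classes of `b + e_j` are exactly the
UNHIT deep classes of `b`, on which G3 (`gHatShift_holds`) gives `ĝ_x(b+e_j) = π_j(x) ĝ_x(b)` exactly; on a HIT deep class `p ∣ π_j(x)`
and `ĝ_x` is a `p`-unit (G1), so those terms are `≡ 0 (mod p)`.  `p`-adic valuations of rationals; nothing about irrationality.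
-/

noncomputable section

open Finset

namespace Summit.KontsevichZagierPeriods.Zeta5Search.ClusterValuation

open Summit.KontsevichZagierPeriods.Zeta5Search.DualSeries (InBox)
open Summit.KontsevichZagierPeriods.Zeta5Search.CasoratianValuation (InPolytope shift)
open Summit.KontsevichZagierPeriods.Zeta5Search.BigPrime (shift_zero)
open Summit.KontsevichZagierPeriods.Zeta5Search.PadicSeries

/-- The residue `x < p` lies in its own class as soon as the class is nonempty (e.g. has negative exponent). -/
theorem self_mem_classSet_of_classExp_neg (b : ℕ → ℤ) {p x : ℕ} (hx : x < p) (hE : classExp b p x < 0) :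
    x ∈ classSet b p x := by
  by_contra hxC
  have hempty : classSet b p x = ∅ := by
    refine eq_empty_of_forall_notMem fun s hs => hxC ?_
    obtain ⟨hsr, hres⟩ := mem_filter.1 hs
    rw [Nat.mod_eq_of_lt hx] at hres
    have hxs : x ≤ s := by rw [← hres]; exact Nat.mod_le _ _
    exact mem_filter.2 ⟨mem_range.2 (lt_of_le_of_lt hxs (mem_range.1 hsr)), rfl⟩
  unfold classExp at hE
  rw [hempty, sum_empty] at hE
  split_ifs at hE <;> omega

/-- **`GHatShiftMoments` is a theorem.** -/
theorem gHatShiftMoments_holds : GHatShiftMoments := by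
  intro b p j N i hb hb' hj1 hj7 hprime hp5 hN hEN
  haveI : Fact p.Prime := ⟨hprime⟩
  classical
  have hbox : InBox b := hb.1
  have hβ0 : 0 ≤ b j := by
    have := (hbox.2 (j - 1) (mem_range.2 (by omega))).1
    rwa [show j - 1 + 1 = j by omega] at this
  have hN0 : 0 ≤ b 0 := hbox.1
  have h2' : 2 * shift b j j ≤ shift b j 0 := by
    have := hb'.2.1 (j - 1) (mem_range.2 (by omega))
    rwa [show j - 1 + 1 = j by omega] at this
  have h2 : 2 * b j + 2 ≤ b 0 := by
    rw [shift_zero b hj1] at h2'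
    simp [shift] at h2'
    linarith
  set β := (b j).toNat with hβ
  set n := (b 0).toNat with hn
  have hβn : (b 0 - b j).toNat = n - β := by omega
  have hβZ : (b j : ℤ) = β := by omega
  have hnβZ : (b 0 - b j : ℤ) = ((n - β : ℕ) : ℤ) := by omega
  -- `netExp` under the shift
  have hnet : ∀ s, netExp (shift b j) s = netExp b s + (if s = β ∨ s = n - β then 1 else 0) :=
    fun s => CellA.netExp_shift_eq b hbox hj1 hj7 (by omega) s
  have hcen : ∀ x, (if ¬ (2 : ℤ) ∣ shift b j 0 ∧ CentreIn (shift b j) p x then (1 : ℤ) else 0) =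
      (if ¬ (2 : ℤ) ∣ b 0 ∧ CentreIn b p x then (1 : ℤ) else 0) := fun x => by
    by_cases h : ¬ (2 : ℤ) ∣ b 0 ∧ CentreIn b p x
    · rw [if_pos h, if_pos (by rw [shift_zero b hj1, centreIn_shift b hj1]; exact h)]
    · rw [if_neg h, if_neg (by rw [shift_zero b hj1, centreIn_shift b hj1]; exact h)]
  -- class exponents under the shift: unhit classes keep `E`, hit classes rise
  have hE_nohit : ∀ x, β ∉ classSet b p x → n - β ∉ classSet b p x → classExp (shift b j) p x = classExp b p x := by
    intro x h1 h2
    unfold classExp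
    rw [classSet_shift b hj1, hcen x]
    congr 1
    refine sum_congr rfl fun s hs => ?_
    rw [hnet s, if_neg (by rintro (rfl | rfl) <;> [exact h1 hs; exact h2 hs]), add_zero]
  have hE_hit : ∀ x, (β ∈ classSet b p x ∨ n - β ∈ classSet b p x) →
      classExp b p x + 1 ≤ classExp (shift b j) p x := by
    intro x hhit
    unfold classExp
    rw [classSet_shift b hj1, hcen x]
    have hsum : ∑ s ∈ classSet b p x, netExp (shift b j) s =
        ∑ s ∈ classSet b p x, netExp b s + ∑ s ∈ classSet b p x, (if s = β ∨ s = n - β then (1 : ℤ) else 0) := by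
      rw [← sum_add_distrib]
      exact sum_congr rfl fun s _ => hnet s
    have hone : (1 : ℤ) ≤ ∑ s ∈ classSet b p x, (if s = β ∨ s = n - β then (1 : ℤ) else 0) := by
      rcases hhit with h | h
      · refine le_trans (by rw [if_pos (Or.inl rfl)]) (single_le_sum (fun s _ => by positivity) h)
      · refine le_trans (by rw [if_pos (Or.inr rfl)]) (single_le_sum (fun s _ => by positivity) h)
    rw [hsum]
    linarith
  -- the deep classes of `b + e_j` are the unhit deep classes of `b`
  set D := deepClasses b p N with hD
  set U := D.filter (fun x => β ∉ classSet b p x ∧ n - β ∉ classSet b p x) with hU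
  have hD' : deepClasses (shift b j) p N = U := by
    ext x
    simp only [hU, hD, deepClasses, mem_filter, mem_range]
    constructor
    · rintro ⟨hx, hE'⟩
      have hEx := hEN x hx
      by_cases hhit : β ∈ classSet b p x ∨ n - β ∈ classSet b p x
      · have := hE_hit x hhit; omega
      · push Not at hhit
        have := hE_nohit x hhit.1 hhit.2
        exact ⟨⟨hx, by omega⟩, hhit.1, hhit.2⟩
    · rintro ⟨⟨hx, hE⟩, h1, h2⟩
      exact ⟨hx, by rw [hE_nohit x h1 h2]; exact hE⟩
  -- the first sum, by G3
  have hsum1 : ∑ x ∈ deepClasses (shift b j) p N, (x : ℚ) ^ i * gHat (shift b j) p x =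
      ∑ x ∈ U, (x : ℚ) ^ i * (((b j : ℚ) - x) * (((b 0 - b j : ℤ) : ℚ) - x)) * gHat b p x := by
    rw [hD']
    refine sum_congr rfl fun x hx => ?_
    obtain ⟨hxD, h1, h2⟩ := mem_filter.1 hx
    obtain ⟨hxr, hE⟩ := mem_filter.1 hxD
    have hx' := mem_range.1 hxr
    have hxC : x ∈ classSet b p x := self_mem_classSet_of_classExp_neg b hx' (by omega)
    rw [gHatShift_holds b p x x j hb hj1 hj7 hb' hprime hp5 hx' hxC h1 (by rwa [hβn])]
    ring
  -- the hit deep terms are `≡ 0 (mod p)`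
  have hterm : ∀ x ∈ D.filter (fun x => ¬ (β ∉ classSet b p x ∧ n - β ∉ classSet b p x)),
      padicNorm p ((x : ℚ) ^ i * (((b j : ℚ) - x) * (((b 0 - b j : ℤ) : ℚ) - x)) * gHat b p x) ≤ (p : ℚ) ^ (-(1 : ℤ)) := by
    intro x hx
    obtain ⟨hxD, hhit⟩ := mem_filter.1 hx
    obtain ⟨hxr, hE⟩ := mem_filter.1 hxD
    have hx' := mem_range.1 hxr
    have hxC : x ∈ classSet b p x := self_mem_classSet_of_classExp_neg b hx' (by omega)
    have hg : padicNorm p (gHat b p x) ≤ 1 := by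
      by_cases h0 : gHat b p x = 0
      · rw [h0, padicNorm.zero]; exact zero_le_one
      · rw [padicNorm.eq_zpow_of_nonzero h0, (gHatClassCongr_holds b p x x x hb hprime hp5 hx' hxC hxC).1, neg_zero, zpow_zero]
    have hxi : padicNorm p ((x : ℚ) ^ i) ≤ 1 := by
      have := padicNorm.of_nat (p := p) (x ^ i)
      exact_mod_cast this
    -- one of the two factors of `π_j(x)` is divisible by `p`
    have hπ : padicNorm p (((b j : ℚ) - x) * (((b 0 - b j : ℤ) : ℚ) - x)) ≤ (p : ℚ) ^ (-(1 : ℤ)) := by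
      have hdvd : ∀ s ∈ classSet b p x, padicNorm p ((s : ℚ) - x) ≤ (p : ℚ) ^ (-(1 : ℤ)) := by
        intro s hs
        have hres : s % p = x := by rw [(mem_filter.1 hs).2, Nat.mod_eq_of_lt hx']
        have hd : (p : ℤ) ∣ (s : ℤ) - x := by
          have := Nat.div_add_mod s p
          exact ⟨(s / p : ℕ), by push_cast; linarith [this, hres]⟩
        have hcast : ((s : ℚ) - x) = (((s : ℤ) - x : ℤ) : ℚ) := by push_cast; ring
        rw [hcast]
        have := padicNorm.dvd_iff_norm_le.1 (show ((p ^ 1 : ℕ) : ℤ) ∣ (s : ℤ) - x by simpa using hd)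
        simpa using this
      have hint1 : padicNorm p ((b j : ℚ) - x) ≤ 1 := by
        have : ((b j : ℚ) - x) = (((b j - x : ℤ)) : ℚ) := by push_cast; ring
        rw [this]; exact padicNorm.of_int _
      have hint2 : padicNorm p ((((b 0 - b j : ℤ) : ℚ)) - x) ≤ 1 := by
        have : ((((b 0 - b j : ℤ) : ℚ)) - x) = (((b 0 - b j - x : ℤ)) : ℚ) := by push_cast; ring
        rw [this]; exact padicNorm.of_int _
      rw [padicNorm.mul]
      rcases not_and_or.1 hhit with h | h
      · push Not at h
        have h1 := hdvd β h
        rw [show ((β : ℕ) : ℚ) = (b j : ℚ) by exact_mod_cast hβZ.symm] at h1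
        calc padicNorm p ((b j : ℚ) - x) * padicNorm p ((((b 0 - b j : ℤ) : ℚ)) - x)
            ≤ (p : ℚ) ^ (-(1 : ℤ)) * 1 := mul_le_mul h1 hint2 (padicNorm.nonneg _) (zpow_p_nonneg _)
          _ = _ := mul_one _
      · push Not at h
        have h1 := hdvd (n - β) h
        rw [show (((n - β : ℕ)) : ℚ) = (((b 0 - b j : ℤ)) : ℚ) by exact_mod_cast hnβZ.symm] at h1
        calc padicNorm p ((b j : ℚ) - x) * padicNorm p ((((b 0 - b j : ℤ) : ℚ)) - x)
            ≤ 1 * (p : ℚ) ^ (-(1 : ℤ)) := mul_le_mul hint1 h1 (padicNorm.nonneg _) zero_le_one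
          _ = _ := one_mul _
    rw [padicNorm.mul, padicNorm.mul]
    calc padicNorm p ((x : ℚ) ^ i) * padicNorm p (((b j : ℚ) - x) * (((b 0 - b j : ℤ) : ℚ) - x)) * padicNorm p (gHat b p x)
        ≤ 1 * (p : ℚ) ^ (-(1 : ℤ)) * 1 :=
          mul_le_mul (mul_le_mul hxi hπ (padicNorm.nonneg _) zero_le_one) hg (padicNorm.nonneg _)
            (mul_nonneg zero_le_one (zpow_p_nonneg _))
      _ = (p : ℚ) ^ (-(1 : ℤ)) := by ring
  -- assemble
  unfold pCong
  rw [decide_eq_true_iff, hsum1, ← sum_filter_add_sum_filter_not D (fun x => β ∉ classSet b p x ∧ n - β ∉ classSet b p x),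
    ← hU, show ∀ a c : ℚ, a - (a + c) = -c from fun a c => by ring]
  by_cases h0 : ∑ x ∈ D.filter (fun x => ¬ (β ∉ classSet b p x ∧ n - β ∉ classSet b p x)),
      (x : ℚ) ^ i * (((b j : ℚ) - x) * (((b 0 - b j : ℤ) : ℚ) - x)) * gHat b p x = 0
  · left; rw [h0, neg_zero]
  · right
    refine val_ge_of_padicNorm_le (neg_ne_zero.2 h0) ?_
    rw [padicNorm.neg]
    exact padicNorm.sum_le' hterm (zpow_p_nonneg _)

end Summit.KontsevichZagierPeriods.Zeta5Search.ClusterValuation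

end
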